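import Summits.QuantumFields.YangMills.Theorems.FluctuationComparisonRegPrIntLS2BetaArcDecayOfGuard
import Summits.QuantumFields.YangMills.Theorems.FluctuationComparisonRegPrIntLS2BetaLiftLadderCombRow
import Summits.QuantumFields.YangMills.Theorems.FluctuationComparisonRegPrIntLS2BetaWhitneyHatLift
import HarnessLib

/-!
# S2β · THE SUP CHAIN ∕ (D-stage): THE (T) LETTER OF THE c₁ CORE ON THE CHART TOWER — the RAW relative chords of the two histories are inside the `SU(2)` chart
# at EVERY averaged level: `‖logVec (Ū^t(e^ζU₀) b·(Ū^t U₀ b)⁻¹)‖ ≤ Mg t ≤ 1∕4`, `Mg t = 2·s₀·q^(K−J−t) + 2·D₁·max α 0`, at the station prefix, from the guard `s₀ ≤ 1∕128`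

Cell `ym3-torus` (rung R3 = continuum `SU(2)` Yang–Mills on T³ at fixed lattice data — NOT d = 4, NOT infinite volume, NOT a mass gap, NOT Clay).  Width seat «width 12»
`ym3-torus-px12` (gen 26), FREE px helper on crux `stmt-QuantumFields-20520`; `--supports` helper, count-neutral, DEFINITION-FREE (0 `def`∕`instance`∕`notation`∕`sorry`,
default heartbeats).

WHY (px10 g26 22:33:13Z, G4-i `…CurlBudgetOfChartTower` 932da2bb: its binder **(T)** `(Mg : ℕ → ℝ) (hMg : ∀ t ≤ K − J, ∀ b, ‖logVec (su2Quat (Ū^t(e^ζU₀) b * (Ū^t U₀ b)⁻¹))‖ ≤ Mg t)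
(hMg4 : ∀ t ≤ K − J, Mg t ≤ 1∕4)` puts the relative average inside the `SU(2)` log chart (`chartRadius = log(4∕3) > 1∕4`); ✓p835698 O's `M t ≤ 1∕2` is too wide —
«O's successor with `s ≤ 1∕8` per tower, or a direct α-bound — say which»).  THIS FILE is the α-road: ✓`…ArcDecayOfGuard` §1 (`arc ≤ s₀·q^(K−J−t) + D₁·α` per gauged
tower, ANY guard threshold `s₀ ≤ 1∕128`) on both towers, the gauge move raw chord = stage chord (✓`norm_logVec_rawChord_eq_stageChord`) and the arc triangle
(✓`norm_logVec_mul_inv_le_add`) at every level `t < K − J`; at the TOP `t = K − J` the two averaged fields COINCIDE by (E4) (✓`iter_eq_of_descendTo_eq`), so the chord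
is `1`.  With `α ≤ α₀′ := min α₀ (15∕(128·(D₁+1)))`: `Mg t = 2·s₀·q^(K−J−t) + 2·D₁·max α 0 ≤ 2∕128 + 30∕128 = 1∕4`.  (`max α 0` only because the prefix does not
give `0 ≤ α` when `J = K`; for `J < K` it is `α`.)

WHAT IS PROVED (sorry-free).  ★★★`relChordChart_of_guard G s₀ hs₀ hGs : ∀ L > 1, ∀ C_B ≥ 0, ∃ α₀ > 0, ∃ q, 0 ≤ q ∧ q < 1 ∧ ∃ D₁ ≥ 0, ∀ F, F.L = L → ⟨station prefix
VERBATIM⟩ → ∃ Mg : ℕ → ℝ, (T) ∧ (∀ t ≤ K−J, Mg t ≤ 1∕4) ∧ (∀ t, Mg t = 2·s₀·q^(K−J−t) + 2·D₁·max α 0)` — px10's `hMg`∕`hMg4` VERBATIM as conjuncts 1–2.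

HONEST SCOPE.  Re-plumbing of landed letters; window, (BKG), (E4), memberships, the 17 `AxStage` clauses are HYPOTHESES; nothing of Bałaban's renormalisation-group
analysis is asserted or proved ([Balaban1985RegularSpaces] Lemma 1 (1.24)–(1.26) p.79, (1.29) p.81; [Balaban1985Averaging] Prop. 4 (128)–(135) pp.37–38).  The c₁ core's
other letters ((SRC), classes, `R`), the SUPPLIER KNIT, GAP♯∘ (`stub_uniformFibreGapOrbit`, registry 3732b7df UNTOUCHED), the five registered stubs (0∕5), S2β, 20520,
19936, 19200, `YM3TorusSU2` are NOT proved; no registered stub is closed; rung R3 — NOT d = 4, NOT infinite volume, NOT a mass gap, NOT Clay; the Yang–Mills mass gap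
is NOT proved.
-/

set_option autoImplicit false

noncomputable section

namespace Summit.QuantumFields.YangMills.Theorems.FluctuationComparisonRegPrIntLS2BetaRelChordChartOfGuard

open Finset
open scoped Real
open Literature.MathematicalPhysics.QuantumLattice (su2Quat)
open Literature.MathematicalPhysics.QuantumFieldTheory.Balaban1983to89
open T4Continuum T3ContinuumYM3Torus T3UnitScaleTilt T3TiltDescent T3LevelShift BlockAveraging
open T4CubeChartGnomonic (SU2)
open T4HaarSU2ExpChart (expPoint)
open T4ExpWindowSmallField (logVec)
open T3UnitLawDensityEML (ℰp)
open T3ConstrainedMinimiser (fibre)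
open ExpMeanLog (deltaSU)
open B10Eq27TorusAxialLog (rel axialT)
open Summit.QuantumFields.YangMills.Theorems.FluctuationComparisonRegPrIntLS2BetaResidualGauge
  (gaugeAct_mul_eq gaugeAct_mem_fibre_iff_of_residual gaugeAct_mem_histGood_iff)
open Summit.QuantumFields.YangMills.Theorems.FluctuationComparisonRegPrIntLS2BetaHFlatOfRelativeLetter (residual_of_iter_eq)
open Summit.QuantumFields.YangMills.Theorems.FluctuationComparisonRegPrIntLS2BetaPeanoSmooth (iter_eq_of_descendTo_eq)
open Summit.QuantumFields.YangMills.Theorems.FluctuationComparisonRegPrIntLS2BetaArcDecayOfGuard (exists_alpha_arcDecay_window)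
open Summit.QuantumFields.YangMills.Theorems.FluctuationComparisonRegPrIntLS2BetaLiftLadderCombRow (norm_logVec_rawChord_eq_stageChord norm_logVec_mul_inv_le_add)
open Summit.QuantumFields.YangMills.Theorems.FluctuationComparisonRegPrIntLS2BetaWhitneyHatLift (logVec_su2Quat_one)

/-- ★★★ **THE (T) LETTER OF THE c₁ CORE ON THE CHART TOWER, FROM THE GUARD**: for every datum class `G` with a small-bond conjunct of ANY threshold `s₀ ≤ 1∕128`,
`∃ α₀ > 0, ∃ q ∈ [0,1), ∃ D₁ ≥ 0` and — under the station prefix of LEAD's knit VERBATIM — a profile `Mg t = 2·s₀·q^(K−J−t) + 2·D₁·max α 0` of the RAW relative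
chords `Ū^t(e^ζU₀)(b)·(Ū^t U₀ (b))⁻¹` at EVERY averaged level `t ≤ K − J`, with `Mg t ≤ 1∕4` (px10's (T) = conjuncts 1–2 VERBATIM).  Proof: ✓`exists_alpha_arcDecay_window`
on both gauged towers + gauge move + arc triangle below the top; the top fields coincide by (E4). [cite: Balaban1985RegularSpaces, Lemma 1 (1.24)-(1.26) p.79, (1.29) p.81;
Balaban1985Averaging, Prop. 4 (128)-(135) pp.37-38] -/
theorem relChordChart_of_guard
    (G : (F : T3Family) → (J : ℕ) → GaugeField (F.P J) 0 (Matrix.specialUnitaryGroup (Fin 2) ℂ) → Prop) (s₀ : ℝ) (hs₀ : s₀ ≤ 1 / 128)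
    (hGs : ∀ (F : T3Family) (J : ℕ) (V : GaugeField (F.P J) 0 (Matrix.specialUnitaryGroup (Fin 2) ℂ)),
      G F J V → ∀ e, ‖logVec (su2Quat (V e))‖ ≤ s₀) :
      ∀ (L : ℕ), 1 < L → ∀ (C_B : ℝ), 0 ≤ C_B → ∃ α₀ : ℝ, 0 < α₀ ∧ ∃ q : ℝ, 0 ≤ q ∧ q < 1 ∧ ∃ D₁ : ℝ, 0 ≤ D₁ ∧ ∀ (F : T3Family), F.L = L →
      ∀ (J K : ℕ) (hJK : J ≤ K) (θ : ℕ → ℝ), (∀ i, 0 ≤ θ i) → ∀ (α : ℝ), (∀ i, J < i → i ≤ K → (((5 * F.L : ℕ) : ℝ) ^ 2 / 4) * θ i ≤ α) →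
        α ≤ 1 / 24 → α < deltaSU (Fin 2) → 157 * α < ((F.L : ℝ) ^ 2)⁻¹ → α ≤ α₀ →
        ∀ U₀ : GaugeField (F.P K) 0 (Matrix.specialUnitaryGroup (Fin 2) ℂ), U₀ ∈ histGood F ℰp θ K J →
        G F J (descendTo F ℰp J K hJK U₀) →
        (∀ t, t ≤ K - J → ∀ p : Plaq (F.P K) t,
          dist1 (GaugeField.plaqHol (Averaging.iter (fun k => BlockAveraging.blockAvg (P := F.P K) (j := k) ℰp) t U₀) p) ≤
            C_B * α * (F.L : ℝ) ^ (2 * t) * ((F.L : ℝ)⁻¹) ^ (2 * (K - J))) →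
        ∀ ζ : PBond (F.P K) 0 → EuclideanSpace ℝ (Fin 3), (∀ ℓ, ‖ζ ℓ‖ ≤ Real.pi) →
          (fun ℓ => expPoint (ζ ℓ) * U₀ ℓ : GaugeField (F.P K) 0 (Matrix.specialUnitaryGroup (Fin 2) ℂ)) ∈ histGood F ℰp θ K J →
            descendTo F ℰp J K hJK (fun ℓ => expPoint (ζ ℓ) * U₀ ℓ : GaugeField (F.P K) 0 (Matrix.specialUnitaryGroup (Fin 2) ℂ)) = descendTo F ℰp J K hJK U₀ →
            ∀ (wt : (j : ℕ) → PBond (F.P K) j → PBond (F.P K) (j + 1) → ℝ)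
            (lift : (j : ℕ) → GaugeField (F.P K) (j + 1) SU2 → GaugeField (F.P K) j SU2)
            (U₁ : GaugeField (F.P K) 0 SU2) (g g₀ : (j : ℕ) → Site (F.P K) j → SU2),
          (∀ j b e, wt j b e = if e.dir = b.dir ∧ (b.src b.dir - emb e.src b.dir).val < (F.P K).L then
              ∏ ν ∈ Finset.univ.erase b.dir, max 0 (1 - ((rel (emb e.src) b.src ν).natAbs : ℝ) / (F.P K).L) else 0) →
          (∀ j X b, lift j X b = expPoint (∑ e, wt j b e • ((((F.P K).L : ℕ) : ℝ)⁻¹ • logVec (su2Quat (X e))))) →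
          (∀ j, j < K - J → ∀ x, g j x =
            (axialT (lift j (GaugeField.gaugeAct (g (j + 1)) (Averaging.iter (fun k => blockAvg (P := F.P K) (j := k) ℰp) (j + 1) (fun ℓ => expPoint (ζ ℓ) * U₀ ℓ))))
                (emb (blockOf x)) x)⁻¹ *
              g (j + 1) (blockOf x) * axialT (Averaging.iter (fun k => blockAvg (P := F.P K) (j := k) ℰp) j (fun ℓ => expPoint (ζ ℓ) * U₀ ℓ)) (emb (blockOf x)) x) →
          (∀ j, K - J ≤ j → ∀ y, g j y = 1) →
          (∀ j, j < K - J → ∀ y : Site (F.P K) (j + 1), g j (emb y) = g (j + 1) y) →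
          (∀ X : GaugeField (F.P K) 0 SU2, ∀ j, j ≤ K - J →
            Averaging.iter (fun k => blockAvg (P := F.P K) (j := k) ℰp) j (GaugeField.gaugeAct (g 0) X) =
              GaugeField.gaugeAct (g j) (Averaging.iter (fun k => blockAvg (P := F.P K) (j := k) ℰp) j X)) →
          (∀ j, j < K - J → ∀ x,
            axialT (GaugeField.gaugeAct (g j) (Averaging.iter (fun k => blockAvg (P := F.P K) (j := k) ℰp) j (fun ℓ => expPoint (ζ ℓ) * U₀ ℓ))) (emb (blockOf x)) x =
              axialT (lift j (GaugeField.gaugeAct (g (j + 1)) (Averaging.iter (fun k => blockAvg (P := F.P K) (j := k) ℰp) (j + 1) (fun ℓ => expPoint (ζ ℓ) * U₀ ℓ))))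
                (emb (blockOf x)) x) →
          (∀ j, j < K - J →
            (blockAvg (P := F.P K) (j := j) ℰp).avg (GaugeField.gaugeAct (g j) (Averaging.iter (fun k => blockAvg (P := F.P K) (j := k) ℰp) j (fun ℓ => expPoint (ζ ℓ) * U₀ ℓ))) =
              GaugeField.gaugeAct (g (j + 1)) (Averaging.iter (fun k => blockAvg (P := F.P K) (j := k) ℰp) (j + 1) (fun ℓ => expPoint (ζ ℓ) * U₀ ℓ))) →
          (∀ j, j < K - J → ∀ x, g₀ j x =
            (axialT (lift j (GaugeField.gaugeAct (g₀ (j + 1)) (Averaging.iter (fun k => blockAvg (P := F.P K) (j := k) ℰp) (j + 1) U₁)))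
                (emb (blockOf x)) x)⁻¹ *
              g₀ (j + 1) (blockOf x) * axialT (Averaging.iter (fun k => blockAvg (P := F.P K) (j := k) ℰp) j U₁) (emb (blockOf x)) x) →
          (∀ j, K - J ≤ j → ∀ y, g₀ j y = 1) →
          (∀ j, j < K - J → ∀ y : Site (F.P K) (j + 1), g₀ j (emb y) = g₀ (j + 1) y) →
          (∀ X : GaugeField (F.P K) 0 SU2, ∀ j, j ≤ K - J →
            Averaging.iter (fun k => blockAvg (P := F.P K) (j := k) ℰp) j (GaugeField.gaugeAct (g₀ 0) X) =
              GaugeField.gaugeAct (g₀ j) (Averaging.iter (fun k => blockAvg (P := F.P K) (j := k) ℰp) j X)) →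
          (∀ j, j < K - J → ∀ x,
            axialT (GaugeField.gaugeAct (g₀ j) (Averaging.iter (fun k => blockAvg (P := F.P K) (j := k) ℰp) j U₁)) (emb (blockOf x)) x =
              axialT (lift j (GaugeField.gaugeAct (g₀ (j + 1)) (Averaging.iter (fun k => blockAvg (P := F.P K) (j := k) ℰp) (j + 1) U₁)))
                (emb (blockOf x)) x) →
          (∀ j, j < K - J →
            (blockAvg (P := F.P K) (j := j) ℰp).avg (GaugeField.gaugeAct (g₀ j) (Averaging.iter (fun k => blockAvg (P := F.P K) (j := k) ℰp) j U₁)) =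
              GaugeField.gaugeAct (g₀ (j + 1)) (Averaging.iter (fun k => blockAvg (P := F.P K) (j := k) ℰp) (j + 1) U₁)) →
          (∀ X : GaugeField (F.P K) 0 SU2, Averaging.iter (fun k => blockAvg (P := F.P K) (j := k) ℰp) (K - J) (GaugeField.gaugeAct (fun x => (g 0 x)⁻¹) X) = Averaging.iter (fun k => blockAvg (P := F.P K) (j := k) ℰp) (K - J) X) →
          (∀ X : GaugeField (F.P K) 0 SU2, Averaging.iter (fun k => blockAvg (P := F.P K) (j := k) ℰp) (K - J) (GaugeField.gaugeAct (g₀ 0) X) = Averaging.iter (fun k => blockAvg (P := F.P K) (j := k) ℰp) (K - J) X) →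
          U₀ = GaugeField.gaugeAct (fun x => (g 0 x)⁻¹ * g₀ 0 x) U₁ →

          ∃ Mg : ℕ → ℝ,
            (∀ t, t ≤ K - J → ∀ b : PBond (F.P K) t,
              ‖logVec (su2Quat (Averaging.iter (fun k => BlockAveraging.blockAvg (P := F.P K) (j := k) ℰp) t (fun ℓ => expPoint (ζ ℓ) * U₀ ℓ : GaugeField (F.P K) 0 (Matrix.specialUnitaryGroup (Fin 2) ℂ)) b * (Averaging.iter (fun k => BlockAveraging.blockAvg (P := F.P K) (j := k) ℰp) t U₀ b)⁻¹))‖ ≤ Mg t) ∧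
            (∀ t, t ≤ K - J → Mg t ≤ 1 / 4) ∧
            (∀ t, Mg t = 2 * s₀ * q ^ (K - J - t) + 2 * D₁ * max α 0) := by
  intro L hL C_B hCB
  obtain ⟨α₀, hα₀, q, hq0, hq1, D₁, hD₁, H⟩ := exists_alpha_arcDecay_window L hL C_B hCB
  refine ⟨min α₀ (15 / (128 * (D₁ + 1))), lt_min hα₀ (by positivity), q, hq0, hq1, D₁, hD₁, ?_⟩
  intro F hFL J K hJK θ hθ0 α hwin h24 hδ _h157 hαα U₀ hU₀g hG hBKG ζ _hζ hWg hfib wt lift U₁ g g₀ hwt hlift _hg hgtop _hgemb hT3 hT4 havg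
    _hg₀ hg₀top _hg₀emb hT3' hT4' havg₀ hres hres₀ hU₀
  have hαα₀ : α ≤ α₀ := hαα.trans (min_le_left _ _)
  have hα15 : α ≤ 15 / (128 * (D₁ + 1)) := hαα.trans (min_le_right _ _)
  have hV : ∀ e', ‖logVec (su2Quat (descendTo F ℰp J K hJK U₀ e'))‖ ≤ s₀ := hGs F J _ hG
  have hs₀0 : 0 ≤ s₀ := (norm_nonneg _).trans (hV ⟨default, ⟨0, (F.P J).hd⟩⟩)
  refine ⟨fun t => 2 * s₀ * q ^ (K - J - t) + 2 * D₁ * max α 0, ?_, ?_, fun t => rfl⟩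
  · intro t ht b
    rcases Nat.lt_or_ge t (K - J) with hlt | hge
    · -- below the top: `J < K`, hence `0 < α`; both gauged towers by ✓`exists_alpha_arcDecay_window`, then gauge move + arc triangle
      have hPd : (F.P K).d = 3 := rfl
      have hαpos : 0 < α := by
        have hd1 : 1 < (F.P K).d := by rw [hPd]; norm_num
        have p₀ : Plaq (F.P K) 0 := ⟨default, ⟨0, by omega⟩, ⟨1, hd1⟩, by show (0 : ℕ) < 1; norm_num⟩
        have h1 := hU₀g 0 (by omega) p₀
        have h3 : 0 < θ (K - 0) := lt_of_le_of_lt (GaugeGroup.dist1_nonneg _) h1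
        rw [Nat.sub_zero] at h3
        have h2 := hwin K (by omega) le_rfl
        have hG5 : (0 : ℝ) < ((5 * F.L : ℕ) : ℝ) ^ 2 / 4 := by
          have : (0 : ℝ) < ((5 * F.L : ℕ) : ℝ) := by rw [hFL]; exact_mod_cast (show 0 < 5 * L by omega)
          positivity
        exact lt_of_lt_of_le (mul_pos hG5 h3) h2
      have hFL0 : (0 : ℝ) < (F.L : ℝ) := by rw [hFL]; exact_mod_cast (lt_trans Nat.zero_lt_one hL)
      have hLL : (F.L : ℝ) ^ (2 * (K - J)) * ((F.L : ℝ)⁻¹) ^ (2 * (K - J)) = 1 := by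
        rw [← mul_pow, mul_inv_cancel₀ hFL0.ne', one_pow]
      have htop₀ : ∀ p : Plaq (F.P K) (K - J),
          dist1 (GaugeField.plaqHol (Averaging.iter (fun k => blockAvg (P := F.P K) (j := k) ℰp) (K - J) U₀) p) ≤ C_B * α := by
        intro p
        have h := hBKG (K - J) le_rfl p
        rw [mul_assoc (C_B * α), hLL, mul_one] at h
        exact h
      have hWtop : ∀ p : Plaq (F.P K) (K - J),
          dist1 (GaugeField.plaqHol (Averaging.iter (fun k => blockAvg (P := F.P K) (j := k) ℰp) (K - J)
            (fun ℓ => expPoint (ζ ℓ) * U₀ ℓ : GaugeField (F.P K) 0 (Matrix.specialUnitaryGroup (Fin 2) ℂ))) p) ≤ C_B * α := by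
        intro p
        rw [iter_eq_of_descendTo_eq F hJK hfib]
        exact htop₀ p
      have hwres : ∀ X : GaugeField (F.P K) 0 SU2,
          descendTo F ℰp J K hJK (GaugeField.gaugeAct (fun x => (g 0 x)⁻¹ * g₀ 0 x) X) = descendTo F ℰp J K hJK X := by
        refine residual_of_iter_eq F hJK _ fun X => ?_
        have e1 : GaugeField.gaugeAct (fun x => (g 0 x)⁻¹ * g₀ 0 x) X =
            GaugeField.gaugeAct (fun x => (g 0 x)⁻¹) (GaugeField.gaugeAct (g₀ 0) X) := gaugeAct_mul_eq (fun x => (g 0 x)⁻¹) (g₀ 0) X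
        rw [e1, hres, hres₀]
      have hU₁f : U₁ ∈ fibre F ℰp J K hJK (descendTo F ℰp J K hJK U₀) := by
        rw [← gaugeAct_mem_fibre_iff_of_residual F hJK hwres U₁, ← hU₀]; exact rfl
      have hU₁g : U₁ ∈ histGood F ℰp θ K J := by
        rw [← gaugeAct_mem_histGood_iff F (fun x => (g 0 x)⁻¹ * g₀ 0 x) θ J U₁, ← hU₀]; exact hU₀g
      have hU₁top : ∀ p : Plaq (F.P K) (K - J),
          dist1 (GaugeField.plaqHol (Averaging.iter (fun k => blockAvg (P := F.P K) (j := k) ℰp) (K - J) U₁) p) ≤ C_B * α := by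
        intro p
        have e1 : Averaging.iter (fun k => blockAvg (P := F.P K) (j := k) ℰp) (K - J) U₁ =
            Averaging.iter (fun k => blockAvg (P := F.P K) (j := k) ℰp) (K - J) U₀ := by
          have e2 : GaugeField.gaugeAct (fun x => (g 0 x)⁻¹ * g₀ 0 x) U₁ =
              GaugeField.gaugeAct (fun x => (g 0 x)⁻¹) (GaugeField.gaugeAct (g₀ 0) U₁) := gaugeAct_mul_eq (fun x => (g 0 x)⁻¹) (g₀ 0) U₁
          rw [hU₀, e2, hres, hres₀]
        rw [e1]
        exact htop₀ p
      have H1 := H F θ hFL hθ0 J K hJK α hwin hαpos h24 hδ hαα₀ s₀ hs₀ (descendTo F ℰp J K hJK U₀) hV _ hfib hWg hWtop g wt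
        (fun t => lift t (GaugeField.gaugeAct (g (t + 1)) (Averaging.iter (fun k => blockAvg (P := F.P K) (j := k) ℰp) (t + 1)
          (fun ℓ => expPoint (ζ ℓ) * U₀ ℓ : GaugeField (F.P K) 0 (Matrix.specialUnitaryGroup (Fin 2) ℂ)))))
        (fun t _ b e' => hwt t b e') (fun t _ b => hlift t _ b) hgtop (fun t ht z => hT4 t ht z) (fun t ht => havg t ht) t ht b
      have H2 := H F θ hFL hθ0 J K hJK α hwin hαpos h24 hδ hαα₀ s₀ hs₀ (descendTo F ℰp J K hJK U₀) hV U₁ hU₁f hU₁g hU₁top g₀ wt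
        (fun t => lift t (GaugeField.gaugeAct (g₀ (t + 1)) (Averaging.iter (fun k => blockAvg (P := F.P K) (j := k) ℰp) (t + 1) U₁)))
        (fun t _ b e' => hwt t b e') (fun t _ b => hlift t _ b) hg₀top (fun t ht z => hT4' t ht z) (fun t ht => havg₀ t ht) t ht b
      have hmax : max α 0 = α := max_eq_left hαpos.le
      rw [norm_logVec_rawChord_eq_stageChord (fun k => blockAvg (P := F.P K) (j := k) ℰp) g g₀ _ U₁ U₀ (fun X => hT3 X t ht) (fun X => hT3' X t ht) hU₀ b]
      calc _ ≤ _ := norm_logVec_mul_inv_le_add _ _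
        _ ≤ (s₀ * q ^ (K - J - t) + D₁ * α) + (s₀ * q ^ (K - J - t) + D₁ * α) := add_le_add H1 H2
        _ = 2 * s₀ * q ^ (K - J - t) + 2 * D₁ * max α 0 := by rw [hmax]; ring
    · -- the top: the two averaged fields coincide by (E4), the chord is `1`
      obtain rfl : t = K - J := le_antisymm ht hge
      rw [iter_eq_of_descendTo_eq F hJK hfib, mul_inv_cancel, logVec_su2Quat_one, norm_zero]
      positivity
  · intro t _
    have hqn : q ^ (K - J - t) ≤ 1 := pow_le_one₀ hq0 hq1.le
    have h1 : 2 * s₀ * q ^ (K - J - t) ≤ 2 * (1 / 128) := by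
      have : s₀ * q ^ (K - J - t) ≤ s₀ * 1 := mul_le_mul_of_nonneg_left hqn hs₀0
      linarith only [this, hs₀]
    have hmaxle : max α 0 ≤ 15 / (128 * (D₁ + 1)) := max_le hα15 (by positivity)
    have h2 : 2 * D₁ * max α 0 ≤ 2 * D₁ * (15 / (128 * (D₁ + 1))) := mul_le_mul_of_nonneg_left hmaxle (by positivity)
    have h3 : 2 * D₁ * (15 / (128 * (D₁ + 1))) ≤ 30 / 128 := by
      rw [show 2 * D₁ * (15 / (128 * (D₁ + 1))) = 30 / 128 * (D₁ / (D₁ + 1)) by field_simp; ring]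
      have : D₁ / (D₁ + 1) ≤ 1 := (div_le_one (by positivity)).2 (by linarith)
      linarith only [this]
    linarith only [h1, h2, h3]

end Summit.QuantumFields.YangMills.Theorems.FluctuationComparisonRegPrIntLS2BetaRelChordChartOfGuard

end
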